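import Literature.NumberTheory.Automorphic.Liu2021.Def411WeilCarriersAtLine
import Literature.RepresentationTheory.TwistedCoinvariantsCompTransport
import HarnessLib

/-!
# [Liu2021, Def. 4.11]'s carrier at a line as `E¹(𝔸_f)`-coinvariants THROUGH the line

Topic `NumberTheory/Automorphic/Liu2021`; namespace `Literature.NumberTheory.Automorphic.Liu2021.Def411WeilCarriers` (sequel of
`Def411WeilCarriersAtLine`).  One `def` with body (`coinvLineCenterEquiv`, a `LinearEquiv`) and theorems; no named facts, no `sorry`.

The at-line carrier `omegaAtLine … a χ = Coinv (finPairRepW … (JW a) … (hs a)) (lineChar a χ.1)` is a space of coinvariants under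
the LINE's unitary group `U(⟨a⟩)(𝔸_{F,f})`; consumers indexing central characters by the norm-one torus `E¹(𝔸_{F,f})`
(`UnitaryGroup.finAdelicOne`) read the same Schwartz module as an `E¹(𝔸_f)`-representation THROUGH the line,
`ρ⋆ := finPairRepW ∘ lineCenterEquiv a` (`u ↦ ω_f(s_a(1, u·1_W))`, [Mok2014, §1]: `U(1) = E¹`).  Since
`lineCenterEquiv a : E¹(𝔸_f) ≃* U(⟨a⟩)(𝔸_f)` is a group isomorphism with `lineChar a χ ∘ lineCenterEquiv a = χ`
(`lineChar_finAdelicCenter`), `TwistedCoinv.coinvTransportEquiv` gives, for every rank `N`, frame `JV`, splitting family `hs` and unit `a`: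
`coinvLineCenterEquiv … a χ : Coinv ρ⋆ χ.1 ≃ₗ[ℂ] omegaAtLine … a χ`, the identity on classes (`coinvLineCenterEquiv_mk`, `_symm_mk`),
intertwining the `U(J_V)(𝔸_{F,f})`-action induced by `finPairRepV` with `rhoVAtLine … a χ` (`coinvLineCenterEquiv_rep`, `_symm_rep`);
and the centre `u·1_V` acts on the source side by `χ u` (`rep_finAdelicCenter_eq_smul`, from `rhoVAtLine_finAdelicCenter`).

## References
* [Liu2021] Y. Liu, *Fourier–Jacobi cycles and arithmetic relative trace formula*, Camb. J. Math. 9 (2021) = arXiv:2102.11518: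
  Def. 4.11 (l. 2092–2096), App. D §D.1 Step 3 (l. 5221).
* [GelbartRogawski1991] S. Gelbart, J. Rogawski, Invent. Math. 105 (1991), §3.1 Prop. 3.1.1 p. 455, Remark p. 457 L4–13.
* [Mok2014] C. P. Mok, *Endoscopic classification of representations of quasi-split unitary groups*, Mem. AMS 235 (2015), §1 Notation p. 5.
-/

set_option autoImplicit false

noncomputable section

/-! ## §2 At the line `⟨a⟩`: `Coinv (finPairRepW ∘ lineCenterEquiv a) ψ̃ ≃ omegaAtLine … a ψ̃` -/

namespace Literature.NumberTheory.Automorphic.Liu2021.Def411WeilCarriers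

open Literature.NumberTheory.Automorphic Literature.NumberTheory.Automorphic.UnitaryGroup
open Literature.NumberTheory.GelbartRogawski1991 Literature.NumberTheory.GelbartRogawski1991.UnitaryDualPair
open Literature.NumberTheory.GelbartRogawski1991.UnitaryDualPair.WeilCoinv
open Literature.NumberTheory.Weil1964 Literature.RepresentationTheory

section AtLine

variable (F E : Type) [Field F] [NumberField F] [Field E] [NumberField E] [Algebra F E]
variable (c : E ≃ₐ[F] E) (N : ℕ) {n : ℕ} (e : Fin N × Fin 1 ≃ Fin n)
variable (JV : Matrix (Fin N) (Fin N) E) {TV : Matrix (Fin N) (Fin N) F}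
variable [Algebra.IsQuadraticExtension F E] {δ : E} (hcδ : c δ = -δ) (hδ : δ ≠ 0) {d : F}
  (hd : δ * δ = algebraMap F E d) (hV : TV.IsSymm) (hVd : IsUnit TV.det) (hJV : JV = TV.map (algebraMap F E))
variable {s : ∀ a : Fˣ, UnitaryGroup.adelicPair F E c N 1 JV (JW F E a) →* adelicMpCont F (Fin n) (adelicGram F e TV (TW F a))}
  (hs : ∀ a : Fˣ, (splittingDatum F E c N 1 e JV (JW F E a) hcδ hδ hd hV (isSymm_TW F a) hVd (isUnit_det_TW F a) hJV
    (JW_eq F E a)).IsCompatible (s a))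

/-- **THE AT-LINE CARRIER AS `E¹(𝔸_f)`-COINVARIANTS THROUGH THE LINE**: for a unit `a` and an automorphic character `ψ̃`,
the `ψ̃`-coinvariants of the finite Weil module of the pair `(V, ⟨a⟩)` under `E¹(𝔸_{F,f})` acting THROUGH `⟨a⟩`
(`ρ⋆ := finPairRepW ∘ lineCenterEquiv a`, `u ↦ ω_f(s_a(1, u·1_W))`) are the carrier `omegaAtLine … a ψ̃` of [Liu2021, Def. 4.11] at
the line `⟨a⟩` — identity on classes. [cite: Liu2021, Def. 4.11 (l. 2092–2096); App. D §D.1 Step 3 (l. 5221)] [cite: Mok2014, §1 Notation p. 5] -/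
def coinvLineCenterEquiv (a : Fˣ) (χ : Chi F E c) :
    TwistedCoinv.Coinv
        ((finPairRepW F E c N 1 e JV (JW F E a) hcδ hδ hd hV (isSymm_TW F a) hVd (isUnit_det_TW F a) hJV (JW_eq F E a)
          (hs a)).comp (lineCenterEquiv F E c a).toMonoidHom) χ.1 ≃ₗ[ℂ]
      omegaAtLine F E c N e JV hcδ hδ hd hV hVd hJV hs a χ :=
  TwistedCoinv.coinvTransportEquiv _ (lineChar F E c a χ.1) (lineCenterEquiv F E c a) χ.1 fun u => by
    rw [lineCenterEquiv_apply, lineChar_finAdelicCenter]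

/-- `coinvLineCenterEquiv (mk v) = mk v`. [cite: Liu2021, App. D §D.1 Step 3 (l. 5221)] -/
@[simp] theorem coinvLineCenterEquiv_mk (a : Fˣ) (χ : Chi F E c) (v : FinSB F (Fin N × Fin 1)) :
    coinvLineCenterEquiv F E c N e JV hcδ hδ hd hV hVd hJV hs a χ
        (TwistedCoinv.mk _ χ.1 v) =
      TwistedCoinv.mk
        (finPairRepW F E c N 1 e JV (JW F E a) hcδ hδ hd hV (isSymm_TW F a) hVd (isUnit_det_TW F a) hJV (JW_eq F E a) (hs a))
        (lineChar F E c a χ.1) v := rfl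

/-- `(coinvLineCenterEquiv).symm (mk v) = mk v`. [cite: Liu2021, App. D §D.1 Step 3 (l. 5221)] -/
@[simp] theorem coinvLineCenterEquiv_symm_mk (a : Fˣ) (χ : Chi F E c) (v : FinSB F (Fin N × Fin 1)) :
    (coinvLineCenterEquiv F E c N e JV hcδ hδ hd hV hVd hJV hs a χ).symm
        (TwistedCoinv.mk
          (finPairRepW F E c N 1 e JV (JW F E a) hcδ hδ hd hV (isSymm_TW F a) hVd (isUnit_det_TW F a) hJV (JW_eq F E a)
            (hs a))
          (lineChar F E c a χ.1) v) =
      TwistedCoinv.mk _ χ.1 v := rfl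

/-- `finPairRepV` commutes with `finPairRepW ∘ lineCenterEquiv a` (the two members of the dual pair commute).
[cite: GelbartRogawski1991, §3.1 Prop. 3.1.1 p. 455] -/
theorem commute_finPairRepV_finPairRepW_comp_lineCenterEquiv (a : Fˣ) (k : UnitaryGroup.finAdelic F E c N JV)
    (u : UnitaryGroup.finAdelicOne F E c) :
    Commute
      (finPairRepV F E c N 1 e JV (JW F E a) hcδ hδ hd hV (isSymm_TW F a) hVd (isUnit_det_TW F a) hJV (JW_eq F E a) (hs a) k)
      (((finPairRepW F E c N 1 e JV (JW F E a) hcδ hδ hd hV (isSymm_TW F a) hVd (isUnit_det_TW F a) hJV (JW_eq F E a)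
          (hs a)).comp (lineCenterEquiv F E c a).toMonoidHom) u) :=
  TwistedCoinv.commute_comp_of_commute _ _ (lineCenterEquiv F E c a).toMonoidHom
    (commute_finPairRepV_finPairRepW F E c N 1 e JV (JW F E a) hcδ hδ hd hV (isSymm_TW F a) hVd (isUnit_det_TW F a) hJV
      (JW_eq F E a) (hs a)) k u

/-- **EQUIVARIANCE**: `coinvLineCenterEquiv` intertwines the `U(J_V)(𝔸_{F,f})`-action induced by `finPairRepV` on
`Coinv (finPairRepW ∘ lineCenterEquiv a) ψ̃` with `rhoVAtLine … a ψ̃`. [cite: Liu2021, Def. 4.11 (l. 2092–2096); App. D §D.1 Steps 2–3 (l. 5217–5221)] -/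
theorem coinvLineCenterEquiv_rep (a : Fˣ) (χ : Chi F E c) (k : UnitaryGroup.finAdelic F E c N JV)
    (x : TwistedCoinv.Coinv
        ((finPairRepW F E c N 1 e JV (JW F E a) hcδ hδ hd hV (isSymm_TW F a) hVd (isUnit_det_TW F a) hJV (JW_eq F E a)
          (hs a)).comp (lineCenterEquiv F E c a).toMonoidHom) χ.1) :
    coinvLineCenterEquiv F E c N e JV hcδ hδ hd hV hVd hJV hs a χ
        (TwistedCoinv.rep χ.1
          (finPairRepV F E c N 1 e JV (JW F E a) hcδ hδ hd hV (isSymm_TW F a) hVd (isUnit_det_TW F a) hJV (JW_eq F E a) (hs a))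
          (commute_finPairRepV_finPairRepW_comp_lineCenterEquiv F E c N e JV hcδ hδ hd hV hVd hJV hs a) k x) =
      rhoVAtLine F E c N e JV hcδ hδ hd hV hVd hJV hs a χ k
        (coinvLineCenterEquiv F E c N e JV hcδ hδ hd hV hVd hJV hs a χ x) := by
  obtain ⟨v, rfl⟩ := TwistedCoinv.mk_surjective _ χ.1 x
  rw [TwistedCoinv.rep_mk, coinvLineCenterEquiv_mk, coinvLineCenterEquiv_mk, rhoVAtLine, weilCoinv_mk, finPairRepV_apply]

/-- the same for the inverse: `(coinvLineCenterEquiv).symm` intertwines `rhoVAtLine … a ψ̃` with the induced action.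
[cite: Liu2021, Def. 4.11 (l. 2092–2096)] -/
theorem coinvLineCenterEquiv_symm_rep (a : Fˣ) (χ : Chi F E c) (k : UnitaryGroup.finAdelic F E c N JV)
    (y : omegaAtLine F E c N e JV hcδ hδ hd hV hVd hJV hs a χ) :
    (coinvLineCenterEquiv F E c N e JV hcδ hδ hd hV hVd hJV hs a χ).symm (rhoVAtLine F E c N e JV hcδ hδ hd hV hVd hJV hs a χ k y) =
      TwistedCoinv.rep χ.1
          (finPairRepV F E c N 1 e JV (JW F E a) hcδ hδ hd hV (isSymm_TW F a) hVd (isUnit_det_TW F a) hJV (JW_eq F E a) (hs a))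
          (commute_finPairRepV_finPairRepW_comp_lineCenterEquiv F E c N e JV hcδ hδ hd hV hVd hJV hs a) k
        ((coinvLineCenterEquiv F E c N e JV hcδ hδ hd hV hVd hJV hs a χ).symm y) := by
  rw [LinearEquiv.symm_apply_eq, coinvLineCenterEquiv_rep, LinearEquiv.apply_symm_apply]

/-- **the centre `u·1_V` of `U(J_V)(𝔸_{F,f})` acts on the source side by `ψ̃ u`** (the central character, transported from
`rhoVAtLine_finAdelicCenter`). [cite: Liu2021, App. D §D.1 Step 3 (l. 5221)] -/
theorem rep_finAdelicCenter_eq_smul (a : Fˣ) (χ : Chi F E c) (u : UnitaryGroup.finAdelicOne F E c)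
    (x : TwistedCoinv.Coinv
        ((finPairRepW F E c N 1 e JV (JW F E a) hcδ hδ hd hV (isSymm_TW F a) hVd (isUnit_det_TW F a) hJV (JW_eq F E a)
          (hs a)).comp (lineCenterEquiv F E c a).toMonoidHom) χ.1) :
    TwistedCoinv.rep χ.1
        (finPairRepV F E c N 1 e JV (JW F E a) hcδ hδ hd hV (isSymm_TW F a) hVd (isUnit_det_TW F a) hJV (JW_eq F E a) (hs a))
        (commute_finPairRepV_finPairRepW_comp_lineCenterEquiv F E c N e JV hcδ hδ hd hV hVd hJV hs a)
        (UnitaryGroup.finAdelicCenter F E c N JV u) x =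
      ((χ.1 u : ℂˣ) : ℂ) • x := by
  apply (coinvLineCenterEquiv F E c N e JV hcδ hδ hd hV hVd hJV hs a χ).injective
  rw [coinvLineCenterEquiv_rep, rhoVAtLine_finAdelicCenter, map_smul]

end AtLine

end Literature.NumberTheory.Automorphic.Liu2021.Def411WeilCarriers

end
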